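import Summits.KontsevichZagierPeriods.KontsevichZagierPeriods.Theorems.RootDecompZetaThreeFrontierWordMatchPreludeP4

/-! # `RootDecompZetaThreeFrontierWordMatchPreludeP5` — part 5/5 of the mechanical ≤360-line split of `MatchPrelude.stripped.lean`
(split by the decomp-kz census seat for landing; mathematics unchanged; part 5 continues part 4). -/

noncomputable section
set_option linter.dupNamespace false

noncomputable section
set_option linter.dupNamespace false
open Set MeasureTheory MvPolynomial
open Literature.NumberTheory.Transcendental
open Summit.KontsevichZagierPeriods.KontsevichZagierPeriods.Theorems.RootDecompZetaThreeFrontierWordMoves (mem_simplex_three_iff)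

namespace Summit.KontsevichZagierPeriods.KontsevichZagierPeriods.Cruxes.GZNormalFormWThree.GZLadder
open Summit.KontsevichZagierPeriods.RootDecompZetaThreeFrontier

/-- the LOW-POLE LAYER `L₃` (`RUNG3.md` §2): reduced data with `α, β₁, γ₁ ≤ 1`, `β₀ + β₁ + α ≤ 2`, `γ₂ + γ₁ + α ≤ 2`
(contains the word `[k3 q] = [Δ₃, q/(t₀t₁(1-t₂))]`, the diagonal-pole class `q/((t₀-t₂)t₁(1-t₂))`, `q/(t₁(t₀-t₂))`, …). -/
def IsLayerThree (r : KZ.IntegralRep 3) : Prop :=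
  r.domain = simplex 3 ∧ ∃ (p : MvPolynomial (Fin 3) ℚ) (β₀ β₁ γ₁ γ₂ α : ℕ),
    α ≤ 1 ∧ β₁ ≤ 1 ∧ γ₁ ≤ 1 ∧ β₀ + β₁ + α ≤ 2 ∧ γ₂ + γ₁ + α ≤ 2 ∧
    EqOn r.integrand (fun t => MvPolynomial.aeval t p /
      (t 0 ^ β₀ * t 1 ^ β₁ * (1 - t 1) ^ γ₁ * (1 - t 2) ^ γ₂ * (t 0 - t 2) ^ α)) r.domain

/-- the layer classes, as a generating set -/
def layerThree : Set KZ.FormalRep := {x | ∃ s : KZ.IntegralRep 3, IsLayerThree s ∧ x = KZ.of s}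

/-- **every admissible layer pattern carries an honest layer rep**: `WordLayer.layerRep P …` IS a layer datum -/
theorem isLayerThree_layerRep (P : MvPolynomial (Fin 3) ℚ) {β₀ β₁ γ₁ γ₂ α : ℕ} (hα : α ≤ 1) (hβ : β₁ ≤ 1) (hγ : γ₁ ≤ 1)
    (h0 : β₀ + β₁ + α ≤ 2) (h1 : γ₂ + γ₁ + α ≤ 2) : IsLayerThree (WordLayer.layerRep P hα hβ hγ h0 h1) :=
  ⟨rfl, P, β₀, β₁, γ₁, γ₂, α, hα, hβ, hγ, h0, h1, fun _ _ => rfl⟩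

/-- … so its class is a layer generator -/
theorem of_layerRep_mem (P : MvPolynomial (Fin 3) ℚ) {β₀ β₁ γ₁ γ₂ α : ℕ} (hα : α ≤ 1) (hβ : β₁ ≤ 1) (hγ : γ₁ ≤ 1)
    (h0 : β₀ + β₁ + α ≤ 2) (h1 : γ₂ + γ₁ + α ≤ 2) : KZ.of (WordLayer.layerRep P hα hβ hγ h0 h1) ∈ layerThree :=
  ⟨WordLayer.layerRep P hα hβ hγ h0 h1, isLayerThree_layerRep P hα hβ hγ h0 h1, rfl⟩

/-- the integrand of the layer rep, for rewriting (`WordLayer.layerF P β₀ β₁ γ₁ γ₂ α t = P(t)/den(t)`) -/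
theorem layerRep_integrand_apply (P : MvPolynomial (Fin 3) ℚ) {β₀ β₁ γ₁ γ₂ α : ℕ} (hα : α ≤ 1) (hβ : β₁ ≤ 1) (hγ : γ₁ ≤ 1)
    (h0 : β₀ + β₁ + α ≤ 2) (h1 : γ₂ + γ₁ + α ≤ 2) (t : Fin 3 → ℝ) :
    (WordLayer.layerRep P hα hβ hγ h0 h1).integrand t =
      MvPolynomial.aeval t P / (t 0 ^ β₀ * t 1 ^ β₁ * (1 - t 1) ^ γ₁ * (1 - t 2) ^ γ₂ * (t 0 - t 2) ^ α) := rfl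

end Summit.KontsevichZagierPeriods.KontsevichZagierPeriods.Cruxes.GZNormalFormWThree.GZLadder

/-! # §27  THE ANALYTIC HALF OF MATCH (decomp-kz lens-1 gen 11, fourth addendum): every ordered reduced datum is, on `Δ₃`,
a finite `ℚ`-combination of ADMISSIBLE GAP CLASSES, each of which is the integrand of an honest `KZ.IntegralRep 3`
(`WordLayer.gapRep`, §26).  What remains of MATCH (`stub_three_match`) after this file is PURE MOVE CALCULUS:
(M0-moves) additivity/scaling in `KZ.relations` to pass from the integrand identity to `KZ.of r ≡ Σ c_κ • KZ.of (gapRep κ)`, and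
(M2–M4) the IBP/Newton–Leibniz steps lowering each admissible gap class into `layerThree ∪ gzLETwo` (NODE.md MATCH BLUEPRINT). -/

namespace Summit.KontsevichZagierPeriods.KontsevichZagierPeriods.Cruxes.GZNormalFormWThree.GZLadder

open Set MeasureTheory Literature.NumberTheory.Transcendental
open Summit.KontsevichZagierPeriods.RootDecompZetaThreeFrontier

/-- Auxiliary step `aeval_gaps_eq_sum`. [bookkeeping] -/
theorem aeval_gaps_eq_sum (H : MvPolynomial (Fin 4) ℚ) (t : Fin 3 → ℝ) :
    MvPolynomial.aeval (WordLayer.gaps t) H = ∑ κ ∈ H.support, ((MvPolynomial.coeff κ H : ℚ) : ℝ) *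
      ((1 - t 0) ^ κ 0 * (t 0 - t 1) ^ κ 1 * (t 1 - t 2) ^ κ 2 * t 2 ^ κ 3) := by
  rw [MvPolynomial.aeval_def, MvPolynomial.eval₂_eq']
  refine Finset.sum_congr rfl fun κ _ => ?_
  simp [Fin.prod_univ_four, eq_ratCast]

/-- **THE ANALYTIC HALF OF MATCH.**  For an ordered reduced datum `r` (`IsReducedOrdThree r`, the output of the PROVED
`stub_three_orders`): `r.domain = Δ₃` and on it `r.integrand = Σ_{κ ∈ supp H} (coeff κ H) · gapF κ β₀ β₁ γ₁ γ₂ α` with EVERY `κ`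
satisfying the five order conditions — so every summand is the integrand of the honest representation `WordLayer.gapRep κ …`
(`gapRep_domain/…_integrand`, §26) on the same domain. -/
theorem integrand_eq_sum_gapF (r : KZ.IntegralRep 3) (h : IsReducedOrdThree r) :
    ∃ (β₀ β₁ γ₁ γ₂ α : ℕ) (H : MvPolynomial (Fin 4) ℚ),
      (∀ κ ∈ H.support, β₀ + β₁ + α ≤ κ 1 + κ 2 + κ 3 + 2 ∧ β₁ ≤ κ 2 + κ 3 + 1 ∧ α ≤ κ 1 + κ 2 + 1 ∧
        γ₁ ≤ κ 0 + κ 1 + 1 ∧ γ₂ + γ₁ + α ≤ κ 0 + κ 1 + κ 2 + 2) ∧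
      r.domain = simplex 3 ∧
      EqOn r.integrand
        (fun t => ∑ κ ∈ H.support, ((MvPolynomial.coeff κ H : ℚ) : ℝ) * WordLayer.gapF κ β₀ β₁ γ₁ γ₂ α t) r.domain := by
  obtain ⟨β₀, β₁, γ₁, γ₂, α, N, H, _hH, hκ, hd, hi⟩ := gapForm_of_isReducedOrdThree r h
  refine ⟨β₀, β₁, γ₁, γ₂, α, H, hκ, hd, fun t ht => ?_⟩
  rw [hi ht]
  simp only [aeval_gaps_eq_sum, Finset.sum_div, WordLayer.gapF, mul_div_assoc]

/-- the summands of `integrand_eq_sum_gapF` are honest representations on `Δ₃ = simplex 3` (pointer to §26 `WordLayer.gapRep`) -/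
theorem gapRep_spec (κ : Fin 4 → ℕ) {β₀ β₁ γ₁ γ₂ α : ℕ} (hV0 : β₀ + β₁ + α ≤ κ 1 + κ 2 + κ 3 + 2)
    (hE1 : β₁ ≤ κ 2 + κ 3 + 1) (hEd : α ≤ κ 1 + κ 2 + 1) (hE2 : γ₁ ≤ κ 0 + κ 1 + 1)
    (hV1 : γ₂ + γ₁ + α ≤ κ 0 + κ 1 + κ 2 + 2) :
    (WordLayer.gapRep κ hV0 hE1 hEd hE2 hV1).domain = simplex 3 ∧
      (WordLayer.gapRep κ hV0 hE1 hEd hE2 hV1).integrand = WordLayer.gapF κ β₀ β₁ γ₁ γ₂ α := ⟨rfl, rfl⟩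

/-- packaged: an ordered reduced datum agrees on `Δ₃` with a finite `ℚ`-combination of integrands of honest gap representations -/
theorem reducedOrd_sum_of_gapReps (r : KZ.IntegralRep 3) (h : IsReducedOrdThree r) :
    ∃ (n : ℕ) (c : Fin n → ℚ) (s : Fin n → KZ.IntegralRep 3),
      (∀ i, (s i).domain = simplex 3 ∧ ∃ (κ : Fin 4 → ℕ) (β₀ β₁ γ₁ γ₂ α : ℕ),
        (β₀ + β₁ + α ≤ κ 1 + κ 2 + κ 3 + 2 ∧ β₁ ≤ κ 2 + κ 3 + 1 ∧ α ≤ κ 1 + κ 2 + 1 ∧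
          γ₁ ≤ κ 0 + κ 1 + 1 ∧ γ₂ + γ₁ + α ≤ κ 0 + κ 1 + κ 2 + 2) ∧
        (s i).integrand = WordLayer.gapF κ β₀ β₁ γ₁ γ₂ α) ∧
      r.domain = simplex 3 ∧
      EqOn r.integrand (fun t => ∑ i, ((c i : ℚ) : ℝ) * (s i).integrand t) r.domain := by
  obtain ⟨β₀, β₁, γ₁, γ₂, α, H, hκ, hd, hi⟩ := integrand_eq_sum_gapF r h
  classical
  set n := H.support.card
  let e : Fin n ≃ H.support := (H.support.equivFin).symm
  refine ⟨n, fun i => MvPolynomial.coeff (e i).1 H, fun i => WordLayer.gapRep (e i).1 (hκ _ (e i).2).1 (hκ _ (e i).2).2.1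
    (hκ _ (e i).2).2.2.1 (hκ _ (e i).2).2.2.2.1 (hκ _ (e i).2).2.2.2.2, fun i => ⟨rfl, (e i).1, β₀, β₁, γ₁, γ₂, α,
    hκ _ (e i).2, rfl⟩, hd, fun t ht => ?_⟩
  rw [hi ht]
  show ∑ κ ∈ H.support, ((MvPolynomial.coeff κ H : ℚ) : ℝ) * WordLayer.gapF κ β₀ β₁ γ₁ γ₂ α t =
    ∑ i : Fin n, ((MvPolynomial.coeff (e i).1 H : ℚ) : ℝ) * WordLayer.gapF (e i).1 β₀ β₁ γ₁ γ₂ α t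
  rw [← Finset.sum_coe_sort H.support]
  exact (Fintype.sum_equiv e _ _ fun i => rfl).symm

end Summit.KontsevichZagierPeriods.KontsevichZagierPeriods.Cruxes.GZNormalFormWThree.GZLadder

end
end
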